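import Mathlib.Topology.MetricSpace.Thickening
import Literature.Probability.RandomPlanarGeometry.UnbasedLoopSpace
import Literature.Probability.Process.PathSpaceBorel
import HarnessLib

/-!
# Unbased loops as a measurable space: hitting events, loops inside a set, unrooting a closed curve

Measure-theoretic complement to `UnbasedLoopSpace` (the metric space `UnbasedLoop E` of closed
curves modulo orientation-preserving reparametrisation of the circle), written as the carrier of
the Brownian loop measure of Lawler–Werner (file `BrownianLoopMeasure`): Lawler–Werner, *The
Brownian loop soup*, PTRF **128** (2004), §4.1, define the loop measure `μ^loop` as a measure on
the metric space of *unrooted loops* `[γ]` ("equivalence classes … `θ_r γ ∼ γ`"), restrict it to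
"loops that lie entirely in `D`, i.e., `γ[0, t_γ] ⊂ D`", and measure "the set of loops in `D`
that intersect both `K₁` and `K₂`" (Lawler, J. Stat. Phys. **134** (2009), §2.2). Here:

* `UnbasedLoop.instMeasurableSpace` — the Borel σ-algebra of the loop metric;
* `UnbasedLoop.inside S = {ℓ | range ℓ ⊆ S}` (loops lying entirely in `S`) and
  `UnbasedLoop.hit K = {ℓ | range ℓ ∩ K ≠ ∅}` (loops intersecting `K`), with
  `hit K = (inside Kᶜ)ᶜ`, `hit (A ∪ B) = hit A ∪ hit B`;
* `UnbasedLoop.isOpen_inside` / `isClosed_inside`: `inside U` is OPEN for open `U` (a compact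
  trace inside `U` has a thickening inside `U`, and traces of loops at distance `< δ` lie in the
  `δ`-thickening of each other, `infDist_range_le_dist`) and CLOSED for closed `U`; hence
  `inside`/`hit` of open or closed sets are Borel (`measurableSet_inside_of_isOpen`, …);
* `Curve.unroot` — the unbased loop of a closed parametrised curve, `1`-Lipschitz from the
  reparametrisation distance (`dist_unroot_le`), hence continuous and Borel measurable, and
  `Curve.measurable_unroot_mk_of_eval`: a random closed curve `ω ↦ γ_ω ∈ C([0,1], E)` all of whose
  evaluations `ω ↦ γ_ω(t)` are measurable defines a measurable random unbased loop (the Borel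
  σ-algebra of `C([0,1], E)` is generated by evaluations, `Process.measurable_continuousMap_of_eval`).

## References

* G. F. Lawler, W. Werner, *The Brownian loop soup*, Probab. Theory Related Fields 128 (2004),
  565–588, §4.1. [LawlerWerner2004]
* G. F. Lawler, *Partition functions, loop measure, and versions of SLE*, J. Stat. Phys. 134
  (2009), 813–837, §2.2. [Lawler2009]
* P. Billingsley, *Convergence of Probability Measures*, 2nd ed. (1999), §7 (random functions).
-/

noncomputable section

open Set Filter Topology MeasureTheory Metric
open scoped unitInterval

namespace Literature.Probability.RandomPlanarGeometry

namespace UnbasedLoop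

variable {E : Type*} [MetricSpace E]

/-- Unbased loops carry the Borel σ-algebra of the loop metric (Lawler–Werner 2004, §4.1: the loop
measure is a measure on the metric space of unrooted loops). [cite: LawlerWerner2004, §4.1] -/
instance instMeasurableSpace : MeasurableSpace (UnbasedLoop E) := borel _

/-- The σ-algebra on unbased loops is the Borel σ-algebra. [folklore] -/
instance instBorelSpace : BorelSpace (UnbasedLoop E) := ⟨rfl⟩

/-- **Loops lying entirely in `S`**: `{ℓ | range ℓ ⊆ S}` (Lawler–Werner 2004, §4.1: "the set of
loops that lie entirely in `D`, i.e., `γ[0, t_γ] ⊂ D`"). [cite: LawlerWerner2004, §4.1] -/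
def inside (S : Set E) : Set (UnbasedLoop E) := {u | u.range ⊆ S}

/-- **Loops intersecting `K`**: `{ℓ | range ℓ ∩ K ≠ ∅}` (Lawler 2009, §2.2: "the set of loops … that
intersect both `K₁` and `K₂`"). [cite: Lawler2009, §2.2] -/
def hit (K : Set E) : Set (UnbasedLoop E) := {u | (u.range ∩ K).Nonempty}

/-- Membership in `inside S`. [folklore] -/
@[simp] theorem mem_inside {S : Set E} {u : UnbasedLoop E} : u ∈ inside S ↔ u.range ⊆ S := Iff.rfl

/-- Membership in `hit K`. [folklore] -/
@[simp] theorem mem_hit {K : Set E} {u : UnbasedLoop E} : u ∈ hit K ↔ (u.range ∩ K).Nonempty :=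
  Iff.rfl

/-- A loop hits `K` iff it does not lie inside `Kᶜ`. [folklore] -/
theorem hit_eq_compl_inside_compl (K : Set E) : hit K = (inside Kᶜ)ᶜ := by
  ext u
  simp only [mem_hit, mem_compl_iff, mem_inside]
  rw [← not_disjoint_iff_nonempty_inter, ← subset_compl_iff_disjoint_right]

/-- `inside` is monotone. [folklore] -/
theorem inside_mono {S T : Set E} (h : S ⊆ T) : inside S ⊆ inside T := fun _ hu ↦ hu.trans h

/-- `hit` is monotone. [folklore] -/
theorem hit_mono {K L : Set E} (h : K ⊆ L) : hit K ⊆ hit L :=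
  fun _ hu ↦ hu.mono (inter_subset_inter_right _ h)

/-- Hitting a union is hitting one of the two sets. [folklore] -/
theorem hit_union (A B : Set E) : hit (A ∪ B) = hit A ∪ hit B := by
  ext u
  simp only [mem_hit, mem_union, inter_union_distrib_left, union_nonempty]

/-- No loop hits the empty set. [folklore] -/
@[simp] theorem hit_empty : hit (∅ : Set E) = ∅ := by
  ext u
  simp

/-- No loop lies inside the empty set (traces are nonempty). [folklore] -/
@[simp] theorem inside_empty : inside (∅ : Set E) = ∅ := by
  ext u
  simp only [mem_inside, subset_empty_iff, mem_empty_iff_false, iff_false]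
  exact u.range_nonempty.ne_empty

/-- Every loop lies inside the whole space. [folklore] -/
@[simp] theorem inside_univ : inside (univ : Set E) = univ := by
  ext u
  simp

/-- `inside (S ∩ T) = inside S ∩ inside T`. [folklore] -/
theorem inside_inter (S T : Set E) : inside (S ∩ T) = inside S ∩ inside T := by
  ext u
  simp [subset_inter_iff]

/-- A loop inside `S` which does not lie inside `S \ A` hits `A`, and conversely:
`inside S \ inside (S \ A) = inside S ∩ hit A`. [folklore] -/
theorem inside_diff_inside_diff (S A : Set E) : inside S \ inside (S \ A) = inside S ∩ hit A := by
  ext u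
  constructor
  · rintro ⟨hS, h⟩
    refine ⟨hS, not_disjoint_iff_nonempty_inter.1 fun hd ↦ h ?_⟩
    exact fun x hx ↦ ⟨hS hx, hd.notMem_of_mem_left hx⟩
  · rintro ⟨hS, ⟨x, hxr, hxA⟩⟩
    exact ⟨hS, fun h' ↦ (h' hxr).2 hxA⟩

/-- **`inside U` is open for open `U`**: if `range ℓ₀ ⊆ U`, some `δ`-thickening of the compact trace
stays in `U`, and every loop at distance `< δ` from `ℓ₀` has its trace in that thickening
(`infDist_range_le_dist`). [folklore] -/
theorem isOpen_inside {U : Set E} (hU : IsOpen U) : IsOpen (inside U) := by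
  rw [Metric.isOpen_iff]
  intro u hu
  obtain ⟨δ, hδ, hthick⟩ := u.isCompact_range.exists_thickening_subset_open hU hu
  refine ⟨δ, hδ, fun v hv x hx ↦ hthick ?_⟩
  rw [Metric.mem_ball] at hv
  exact (mem_thickening_iff_infDist_lt u.range_nonempty).2
    ((infDist_range_le_dist v u hx).trans_lt hv)

/-- **`inside F` is closed for closed `F`**: if `ℓₙ → ℓ` with `range ℓₙ ⊆ F`, every point of
`range ℓ` is at distance `≤ dist ℓ ℓₙ → 0` from `F`. [folklore] -/
theorem isClosed_inside {F : Set E} (hF : IsClosed F) : IsClosed (inside F) := by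
  refine isClosed_of_closure_subset fun u hu x hx ↦ ?_
  rw [Metric.mem_closure_iff] at hu
  rcases F.eq_empty_or_nonempty with rfl | hFne
  · obtain ⟨v, hv, -⟩ := hu 1 one_pos
    exact absurd hv (by simp)
  have h0 : infDist x F = 0 := by
    refine le_antisymm (le_of_forall_pos_le_add fun ε hε ↦ ?_) infDist_nonneg
    obtain ⟨v, hv, huv⟩ := hu ε hε
    calc infDist x F ≤ infDist x v.range := infDist_le_infDist_of_subset hv v.range_nonempty
      _ ≤ dist u v := infDist_range_le_dist u v hx
      _ ≤ 0 + ε := by rw [zero_add]; exact huv.le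
  have := (mem_closure_iff_infDist_zero hFne).2 h0
  rwa [hF.closure_eq] at this

/-- `inside U` is Borel for open `U`. [folklore] -/
theorem measurableSet_inside_of_isOpen {U : Set E} (hU : IsOpen U) : MeasurableSet (inside U) :=
  (isOpen_inside hU).measurableSet

/-- `inside F` is Borel for closed `F`. [folklore] -/
theorem measurableSet_inside_of_isClosed {F : Set E} (hF : IsClosed F) :
    MeasurableSet (inside F) :=
  (isClosed_inside hF).measurableSet

/-- `hit K` is Borel (indeed closed) for closed `K`. [folklore] -/
theorem measurableSet_hit_of_isClosed {K : Set E} (hK : IsClosed K) : MeasurableSet (hit K) := by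
  rw [hit_eq_compl_inside_compl]
  exact (measurableSet_inside_of_isOpen hK.isOpen_compl).compl

/-- `hit U` is Borel (indeed open) for open `U`. [folklore] -/
theorem measurableSet_hit_of_isOpen {U : Set E} (hU : IsOpen U) : MeasurableSet (hit U) := by
  rw [hit_eq_compl_inside_compl]
  exact (measurableSet_inside_of_isClosed hU.isClosed_compl).compl

end UnbasedLoop

/-! ### Unrooting a closed parametrised curve -/

namespace Curve

variable {E : Type*} [MetricSpace E]

/-- **The unbased loop of a closed curve**: forget the parametrisation (`CurveClass.mk`) and the
base point (`UnbasedLoop.mk`) of a curve `γ` with `γ 0 = γ 1` (Lawler–Werner 2004, §4.1: "Any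
measure supported on [rooted loops] gives a measure on [unrooted loops] by 'forgetting the root',
i.e., by considering the map `γ ↦ [γ]`"). [cite: LawlerWerner2004, §4.1] -/
def unroot (γ : {γ : Curve E // γ.IsLoop}) : UnbasedLoop E :=
  UnbasedLoop.mk (BasedLoop.mk (CurveClass.mk γ.1) γ.2)

/-- Unrooting does not change the trace. [folklore] -/
@[simp] theorem range_unroot (γ : {γ : Curve E // γ.IsLoop}) : (unroot γ).range = γ.1.range := rfl

/-- The loop distance of unrooted curves is at most their reparametrisation distance. [folklore] -/
theorem dist_unroot_le (γ γ' : {γ : Curve E // γ.IsLoop}) :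
    dist (unroot γ) (unroot γ') ≤ dist γ.1 γ'.1 :=
  Curve.loopDist_le_reparamDist γ.1 γ'.1

/-- Unrooting is `1`-Lipschitz (for the subspace distance of closed curves). [folklore] -/
theorem lipschitzWith_unroot : LipschitzWith 1 (unroot : {γ : Curve E // γ.IsLoop} → UnbasedLoop E) :=
  LipschitzWith.mk_one dist_unroot_le

/-- Unrooting is continuous. [folklore] -/
@[fun_prop] theorem continuous_unroot : Continuous (unroot : {γ : Curve E // γ.IsLoop} → UnbasedLoop E) :=
  lipschitzWith_unroot.continuous

/-- Unrooting is Borel measurable. [folklore] -/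
theorem measurable_unroot : Measurable (unroot : {γ : Curve E // γ.IsLoop} → UnbasedLoop E) :=
  continuous_unroot.measurable

/-- **A random closed curve with measurable evaluations is a random unbased loop**: if
`Φ : Ω → C([0, 1], E)` takes values in closed curves and each `ω ↦ Φ ω t` is measurable, then
`ω ↦ [Φ ω]` is a measurable map into `UnbasedLoop E` (the Borel σ-algebra of `C([0, 1], E)` is
generated by the evaluations — Billingsley (1999), §7, `Process.measurable_continuousMap_of_eval` —
and `C([0,1], E) → Curve E → UnbasedLoop E` is `1`-Lipschitz). [folklore] -/
theorem measurable_unroot_mk_of_eval [MeasurableSpace E] [BorelSpace E] [SecondCountableTopology E]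
    {Ω : Type*} [MeasurableSpace Ω] {Φ : Ω → C(I, E)} (hΦ : ∀ t, Measurable fun ω ↦ Φ ω t)
    (hloop : ∀ ω, (Curve.mk (Φ ω)).IsLoop) :
    Measurable fun ω ↦ unroot ⟨Curve.mk (Φ ω), hloop ω⟩ := by
  have h1 : Measurable[_, borel C(I, E)] Φ := Process.measurable_continuousMap_of_eval hΦ
  have h2 : Measurable[borel C(I, E), _] (Curve.mk : C(I, E) → Curve E) :=
    lipschitzWith_mk.continuous.borel_measurable
  exact measurable_unroot.comp ((h2.comp h1).subtype_mk)

end Curve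

end Literature.Probability.RandomPlanarGeometry

end
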